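import Mathlib
import HarnessLib
import Summits.KontsevichZagierPeriods.Zeta5Search.TwoTaleSecondTaleLineRep
import Summits.KontsevichZagierPeriods.Zeta5Search.TwoTaleRungALineBoundRate
import Summits.KontsevichZagierPeriods.Zeta5Search.TwoTaleLineBoundRCT
import Summits.KontsevichZagierPeriods.Zeta5Search.TwoTaleSecondTaleLineRate
import Summits.KontsevichZagierPeriods.Zeta5Search.Denom.TwoTaleD1Forms

/-!
# Second tale at D1's partner `(47,16,19,22 | 22,9,35,38)·n`: the scaled line bound for `R̂ₙ`

HONEST FRAMING: systematic search; no irrationality claim unless certified.  Cell pub-zeta5 (P1 g12 draft of file M2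
of fam-denom's `families/denom/D1-DESIGN-NOTE.md`; design `families/measure/D1-DECAYT-DESIGN.md` §2–§3 (fam-measure
g7); the P15 file `TwoTaleSecondTaleLineRate` (fam-measure g5) is followed line by line).  No measure or
irrationality claim is made here.
An explicit **one-variable rate function** `rateTD1` and the bound, for `n ≥ 1`, `η ≠ 0`, on the line
`Re t = wₙ := −27n/2 − ¾ + ⌊16n/25⌋/2` of the `t`-plane (design abscissa `ξ₀ = −1318/100`, the line of the one-variable
certificate `TwoTaleD1SecondLineProfileShape/Certificate`; the image of the `u`-line `Re u = 11n + ⌊16n/25⌋ + ½`,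
`u = 2t + â₀*`, `â₀* = 38n+2`, of `TwoTaleSecondTaleD1StripShift`):
  `log ‖R̂ₙ(wₙ + i·nη)‖ ≤ n·rateTD1 η + 8·log(19² + (2η)²) + constLineTD1`,
where `R̂ₙ = RCT (aTD1 n) (bTD1 n)` is Zudilin's second-tale rational function [Zudilin2014ZetaTwo, (25)]
`normT · ∏_{l∈[22n+2,47n+2)}(2t+l) · ∏_{[9n+1,16n+1)}(t+i) / (∏_{[19n+1,35n+2)}(t+i) · ∏_{[22n+1,38n+2)}(t+i))`.
Ingredients (all tree): `TwoTaleLineBoundRCT.log_norm_RCT_le` (general `(â,b̂)`), the Lipschitz endpoint transfer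
`prim_endpoint_gen` (window `½ ≤ |W| ≤ 27`), `halfLog_endpoint_gen`, two-sided Stirling for
`normT = (16n)!²/((25n)!(7n)!)` (`κ_T(D1) = 32 log 16 − 25 log 25 − 7 log 7`); the wider window is absorbed by
`log(27² + (2η)²) ≤ log(729/361) + log(19² + (2η)²)` so that the P15 majorant of `TwoTaleSecondTaleLineDecay` applies.
Numerically `sup_η (rateTD1 η − 2π|η|) = −42.3343781` at `η ≈ ±1.86981` (two implementations: fam-measure `rateT_D1.py`,
P1 `code/p1/g12/d1_tale2_profile.py`); `rateTD1 η = profileTD10 (−1318/100) η` is proved in `TwoTaleSecondTaleD1LineDecay`.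
References: W. Zudilin, arXiv:1310.1526 [Zudilin2014ZetaTwo] §6, (25), Prop. 3.
-/

noncomputable section

open Real Complex Finset Polynomial
open Literature.NumberTheory.Irrationality.Zudilin2014
open Summit.KontsevichZagierPeriods.Zeta5Search.TwoTaleLineBound
open Summit.KontsevichZagierPeriods.Zeta5Search.TwoTaleSecondTaleLineRep
open Summit.KontsevichZagierPeriods.Zeta5Search.Denom.TwoTaleD1Forms (aTD1 bTD1 aTD1_zero aTD1_one aTD1_two aTD1_three
  bTD1_zero bTD1_one bTD1_two bTD1_three)

namespace Summit.KontsevichZagierPeriods.Zeta5Search.TwoTaleSecondTaleD1LineRate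

variable {y η : ℝ}

/-! ### The partner's data -/

/-- The design line `Re t = wₙ := −27n/2 − ¾ + ⌊16n/25⌋/2` (image of `Re u = 11n + ⌊16n/25⌋ + ½`; `wₙ/n → −1318/100`). -/
def wLineTD1 (n : ℕ) : ℝ := -(27 * (n : ℝ)) / 2 - 3 / 4 + ((16 * n / 25 : ℕ) : ℝ) / 2

/-- The entropy row `κ_T(D1) = 32 log 16 − 25 log 25 − 7 log 7` of `normT = (16n)!²/((25n)!(7n)!)`. -/
def kappaTD1 : ℝ := 32 * Real.log 16 - 25 * Real.log 25 - 7 * Real.log 7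

/-- **The D1 tale-2 rate function at `ξ₀ = −1318/100`** (doubled block at height `2η`, legs `2ξ₀+47 = 516/25`,
`2ξ₀+22 = −109/25`; `t+i` blocks: numerator legs `ξ₀+16 = 141/50`, `ξ₀+9 = −209/50`, denominator legs
`ξ₀+35 = 1091/50 | ξ₀+19 = 291/50` and `ξ₀+38 = 1241/50 | ξ₀+22 = 441/50`): `Σ± prim + κ_T(D1)`. -/
def rateTD1 (η : ℝ) : ℝ :=
  (prim (2 * η) (516 / 25) - prim (2 * η) (-109 / 25)) + (prim η (141 / 50) - prim η (-209 / 50))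
    - (prim η (1091 / 50) - prim η (291 / 50)) - (prim η (1241 / 50) - prim η (441 / 50)) + kappaTD1

/-- The additive constant of the line bound (`8 log(729/361)` absorbs the window `|W| ≤ 27` into `log(19² + ·)`). -/
def constLineTD1 : ℝ := 12 * |Real.log (1 / 2)| + 2 * (1 + Real.log 2) + 3 + 8 * Real.log (729 / 361)

/-- `normT` at the D1 partner: `(16n)!²/((25n)!(7n)!)`. -/
theorem normT_TD1 (n : ℕ) : normT (aTD1 n) (bTD1 n) =
    ((16 * n).factorial : ℚ) ^ 2 / (((25 * n).factorial : ℚ) * ((7 * n).factorial : ℚ)) := by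
  have e2 : (bTD1 n 2 - aTD1 n 2 - 1).toNat = 16 * n := by rw [aTD1_two, bTD1_two]; omega
  have e3 : (bTD1 n 3 - aTD1 n 3 - 1).toNat = 16 * n := by rw [aTD1_three, bTD1_three]; omega
  have e0 : (aTD1 n 0 - bTD1 n 0).toNat = 25 * n := by rw [aTD1_zero, bTD1_zero]; omega
  have e1 : (aTD1 n 1 - bTD1 n 1).toNat = 7 * n := by rw [aTD1_one, bTD1_one]; omega
  unfold normT facZ
  rw [e2, e3, e0, e1]
  ring

/-- `log normT` at the D1 partner as factorial logs. -/
theorem log_normT_TD1 (n : ℕ) : Real.log (normT (aTD1 n) (bTD1 n) : ℝ) =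
    2 * Real.log ((16 * n).factorial : ℝ) - Real.log ((25 * n).factorial : ℝ) - Real.log ((7 * n).factorial : ℝ) := by
  rw [normT_TD1]
  push_cast
  have h : ∀ k : ℕ, (0 : ℝ) < (k.factorial : ℝ) := fun k => by exact_mod_cast Nat.factorial_pos k
  rw [Real.log_div (pow_ne_zero _ (h _).ne') (mul_ne_zero (h _).ne' (h _).ne'), Real.log_mul (h _).ne' (h _).ne',
    Real.log_pow]
  push_cast
  ring

/-- **Stirling for `normT`** (`n ≥ 1`): `log normT ≤ n·κ_T(D1) + 3` (the `n log n` and `n` rows cancel;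
`½(log 256 − log 175) ≤ ½(256/175 − 1)`). -/
theorem log_normT_TD1_le {n : ℕ} (hn : 1 ≤ n) : Real.log (normT (aTD1 n) (bTD1 n) : ℝ) ≤ n * kappaTD1 + 3 := by
  have hn0 : (0 : ℝ) < n := by exact_mod_cast hn
  rw [log_normT_TD1]
  have c16 : Real.log ((16 * n : ℕ) : ℝ) = Real.log 16 + Real.log n := by
    push_cast; exact Real.log_mul (by norm_num) hn0.ne'
  have c25 : Real.log ((25 * n : ℕ) : ℝ) = Real.log 25 + Real.log n := by
    push_cast; exact Real.log_mul (by norm_num) hn0.ne'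
  have c7 : Real.log ((7 * n : ℕ) : ℝ) = Real.log 7 + Real.log n := by
    push_cast; exact Real.log_mul (by norm_num) hn0.ne'
  have s16 := (log_factorial_two_sided (n := 16 * n) (by omega)).2
  have s25 := (log_factorial_two_sided (n := 25 * n) (by omega)).1
  have s7 := (log_factorial_two_sided (n := 7 * n) (by omega)).1
  rw [c16] at s16; rw [c25] at s25; rw [c7] at s7
  simp only [Nat.cast_mul, Nat.cast_ofNat] at s16 s25 s7
  have q16 : (16 * (n : ℝ)) * (Real.log 16 + Real.log n) = 16 * (n * Real.log 16) + 16 * (n * Real.log n) := by ring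
  have q25 : (25 * (n : ℝ)) * (Real.log 25 + Real.log n) = 25 * (n * Real.log 25) + 25 * (n * Real.log n) := by ring
  have q7 : (7 * (n : ℝ)) * (Real.log 7 + Real.log n) = 7 * (n * Real.log 7) + 7 * (n * Real.log n) := by ring
  have hκ : (n : ℝ) * kappaTD1 = 32 * (n * Real.log 16) - 25 * (n * Real.log 25) - 7 * (n * Real.log 7) := by
    unfold kappaTD1; ring
  have hhalf : 2 * Real.log 16 - Real.log 25 - Real.log 7 ≤ 256 / 175 - 1 := by
    have e : 2 * Real.log 16 - Real.log 25 - Real.log 7 = Real.log (256 / 175) := by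
      rw [Real.log_div (by norm_num) (by norm_num), show (256 : ℝ) = 16 ^ 2 by norm_num, Real.log_pow,
        show (175 : ℝ) = 25 * 7 by norm_num, Real.log_mul (by norm_num) (by norm_num)]
      push_cast; ring
    rw [e]; exact Real.log_le_sub_one_of_pos (by norm_num)
  rw [hκ]
  linarith

/-! ### The line bound -/

set_option maxHeartbeats 400000 in
/-- **The scaled line bound for the second tale at D1**: for `n ≥ 1`, `η ≠ 0`,
`log ‖RCT (aTD1 n) (bTD1 n) (wₙ + i·nη)‖ ≤ n·rateTD1 η + 8 log(19² + (2η)²) + constLineTD1`. -/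
theorem log_norm_RCT_TD1_line_le (hη : η ≠ 0) {n : ℕ} (hn : 1 ≤ n) :
    Real.log ‖RCT (aTD1 n) (bTD1 n) ((wLineTD1 n : ℂ) + (((n : ℝ) * η : ℝ) : ℂ) * I)‖ ≤
      n * rateTD1 η + 8 * Real.log (19 ^ 2 + (2 * η) ^ 2) + constLineTD1 := by
  have hn0 : (0 : ℝ) < n := by exact_mod_cast hn
  have hn1 : (1 : ℝ) ≤ n := by exact_mod_cast hn
  have hy : (n : ℝ) * η ≠ 0 := mul_ne_zero hn0.ne' hη
  have hη2 : 2 * η ≠ 0 := mul_ne_zero two_ne_zero hη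
  have hη22 : 0 ≤ (2 * η) ^ 2 := sq_nonneg _
  have hsq : (27 : ℝ) ^ 2 + η ^ 2 ≤ 27 ^ 2 + (2 * η) ^ 2 := by nlinarith [sq_nonneg η]
  have hlog12 : Real.log (27 ^ 2 + η ^ 2) / 2 ≤ Real.log (27 ^ 2 + (2 * η) ^ 2) / 2 :=  -- `/2`: linarith normal form
    div_le_div_of_nonneg_right (Real.log_le_log (by positivity) hsq) (by norm_num)
  -- the window `27` folded back into `19`: `log(27² + x) ≤ log(729/361) + log(19² + x)`
  have hlog27 : Real.log (27 ^ 2 + (2 * η) ^ 2) ≤ Real.log (729 / 361) + Real.log (19 ^ 2 + (2 * η) ^ 2) := by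
    have h' : (27 : ℝ) ^ 2 + (2 * η) ^ 2 ≤ 729 / 361 * (19 ^ 2 + (2 * η) ^ 2) := by norm_num; linarith
    rw [← Real.log_mul (by norm_num) (by positivity)]
    exact Real.log_le_log (by positivity) h'
  have h32 : (3 : ℝ) / (2 * n) ≤ 3 / 2 := div_le_div_of_nonneg_left (by norm_num) (by norm_num) (by linarith only [hn1])
  have a1 : 1 / 2 + 3 / (2 * (n : ℝ)) ≤ |(516 / 25 : ℝ)| ∧ |(516 / 25 : ℝ)| + 3 / 2 ≤ 27 := by
    rw [abs_of_pos (by norm_num)]; constructor <;> linarith only [h32]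
  have a2 : 1 / 2 + 3 / (2 * (n : ℝ)) ≤ |(-109 / 25 : ℝ)| ∧ |(-109 / 25 : ℝ)| + 3 / 2 ≤ 27 := by
    rw [abs_of_neg (by norm_num)]; constructor <;> linarith only [h32]
  have a3 : 1 / 2 + 3 / (2 * (n : ℝ)) ≤ |(141 / 50 : ℝ)| ∧ |(141 / 50 : ℝ)| + 3 / 2 ≤ 27 := by
    rw [abs_of_pos (by norm_num)]; constructor <;> linarith only [h32]
  have a4 : 1 / 2 + 3 / (2 * (n : ℝ)) ≤ |(-209 / 50 : ℝ)| ∧ |(-209 / 50 : ℝ)| + 3 / 2 ≤ 27 := by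
    rw [abs_of_neg (by norm_num)]; constructor <;> linarith only [h32]
  have a5 : 1 / 2 + 3 / (2 * (n : ℝ)) ≤ |(1091 / 50 : ℝ)| ∧ |(1091 / 50 : ℝ)| + 3 / 2 ≤ 27 := by
    rw [abs_of_pos (by norm_num)]; constructor <;> linarith only [h32]
  have a6 : 1 / 2 + 3 / (2 * (n : ℝ)) ≤ |(291 / 50 : ℝ)| ∧ |(291 / 50 : ℝ)| + 3 / 2 ≤ 27 := by
    rw [abs_of_pos (by norm_num)]; constructor <;> linarith only [h32]
  have a7 : 1 / 2 + 3 / (2 * (n : ℝ)) ≤ |(1241 / 50 : ℝ)| ∧ |(1241 / 50 : ℝ)| + 3 / 2 ≤ 27 := by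
    rw [abs_of_pos (by norm_num)]; constructor <;> linarith only [h32]
  have a8 : 1 / 2 + 3 / (2 * (n : ℝ)) ≤ |(441 / 50 : ℝ)| ∧ |(441 / 50 : ℝ)| + 3 / 2 ≤ 27 := by
    rw [abs_of_pos (by norm_num)]; constructor <;> linarith only [h32]
  obtain ⟨hm, hM, hM0⟩ : (0 : ℝ) < 1 / 2 ∧ (1 : ℝ) ≤ 27 ∧ (0 : ℝ) ≤ 27 := by norm_num
  set w : ℝ := wLineTD1 n with hw
  have hwdef : w = -(27 * (n : ℝ)) / 2 - 3 / 4 + ((16 * n / 25 : ℕ) : ℝ) / 2 := rfl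
  have hj0 : (0 : ℝ) ≤ ((16 * n / 25 : ℕ) : ℝ) := Nat.cast_nonneg _
  have hj1 : (25 : ℝ) * ((16 * n / 25 : ℕ) : ℝ) ≤ 16 * n := by exact_mod_cast Nat.mul_div_le (16 * n) 25
  have hj2 : 16 * (n : ℝ) < 25 * ((16 * n / 25 : ℕ) : ℝ) + 25 := by
    exact_mod_cast (by omega : 16 * n < 25 * (16 * n / 25) + 25)
  obtain ⟨e1a, e1b⟩ := abs_le.1 (prim_endpoint_gen hη2 hn hm hM (E := 2 * w + (47 * n + 1)) (Vs := 516 / 25)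
    (by rw [abs_le]; constructor <;> linarith only [hwdef, hj1, hj2]) a1.1 a1.2)
  obtain ⟨e2a, e2b⟩ := abs_le.1 (prim_endpoint_gen hη2 hn hm hM (E := 2 * w + (22 * n + 2)) (Vs := -109 / 25)
    (by rw [abs_le]; constructor <;> linarith only [hwdef, hj1, hj2]) a2.1 a2.2)
  obtain ⟨e3a, e3b⟩ := abs_le.1 (prim_endpoint_gen hη hn hm hM (E := w + 16 * n) (Vs := 141 / 50)
    (by rw [abs_le]; constructor <;> linarith only [hwdef, hj1, hj2]) a3.1 a3.2)
  obtain ⟨e4a, e4b⟩ := abs_le.1 (prim_endpoint_gen hη hn hm hM (E := w + (9 * n + 1)) (Vs := -209 / 50)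
    (by rw [abs_le]; constructor <;> linarith only [hwdef, hj1, hj2]) a4.1 a4.2)
  obtain ⟨e5a, e5b⟩ := abs_le.1 (prim_endpoint_gen hη hn hm hM (E := w + (35 * n + 1)) (Vs := 1091 / 50)
    (by rw [abs_le]; constructor <;> linarith only [hwdef, hj1, hj2]) a5.1 a5.2)
  obtain ⟨e6a, e6b⟩ := abs_le.1 (prim_endpoint_gen hη hn hm hM (E := w + (19 * n + 1) - 1) (Vs := 291 / 50)
    (by rw [abs_le]; constructor <;> linarith only [hwdef, hj1, hj2]) a6.1 a6.2)
  obtain ⟨e7a, e7b⟩ := abs_le.1 (prim_endpoint_gen hη hn hm hM (E := w + (38 * n + 1)) (Vs := 1241 / 50)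
    (by rw [abs_le]; constructor <;> linarith only [hwdef, hj1, hj2]) a7.1 a7.2)
  obtain ⟨e8a, e8b⟩ := abs_le.1 (prim_endpoint_gen hη hn hm hM (E := w + (22 * n + 1) - 1) (Vs := 441 / 50)
    (by rw [abs_le]; constructor <;> linarith only [hwdef, hj1, hj2]) a8.1 a8.2)
  have l1 := halfLog_endpoint_gen hη2 hn hM0 (E := 2 * w + (22 * n + 2))
    (by rw [abs_le]; constructor <;> linarith only [hwdef, hn1, hj0, hj1])
  have l2 := halfLog_endpoint_gen hη2 hn hM0 (E := 2 * w + (47 * n + 1))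
    (by rw [abs_le]; constructor <;> linarith only [hwdef, hn1, hj0, hj1])
  have l3 := halfLog_endpoint_gen hη hn hM0 (E := w + (9 * n + 1))
    (by rw [abs_le]; constructor <;> linarith only [hwdef, hn1, hj0, hj1])
  have l4 := halfLog_endpoint_gen hη hn hM0 (E := w + 16 * n)
    (by rw [abs_le]; constructor <;> linarith only [hwdef, hn1, hj0, hj1])
  have hG : (n : ℝ) * rateTD1 η = n * prim (2 * η) (516 / 25) - n * prim (2 * η) (-109 / 25)
      + (n * prim η (141 / 50) - n * prim η (-209 / 50)) - (n * prim η (1091 / 50) - n * prim η (291 / 50))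
      - (n * prim η (1241 / 50) - n * prim η (441 / 50)) + n * kappaTD1 := by
    unfold rateTD1; ring
  have h0 : bTD1 n 0 + 2 ≤ aTD1 n 0 := by rw [aTD1_zero, bTD1_zero]; omega
  have h1 : bTD1 n 1 + 2 ≤ aTD1 n 1 := by rw [aTD1_one, bTD1_one]; omega
  have h2 : aTD1 n 2 < bTD1 n 2 := by rw [aTD1_two, bTD1_two]; omega
  have h3 : aTD1 n 3 < bTD1 n 3 := by rw [aTD1_three, bTD1_three]; omega
  have c2a : ((aTD1 n 2 : ℤ) : ℝ) = 19 * n + 1 := by rw [aTD1_two]; push_cast; ring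
  have c3a : ((aTD1 n 3 : ℤ) : ℝ) = 22 * n + 1 := by rw [aTD1_three]; push_cast; ring
  have hw2 : 1 ≤ w + ((aTD1 n 2 : ℤ) : ℝ) := by rw [c2a]; linarith only [hwdef, hn1, hj0]
  have hw3 : 1 ≤ w + ((aTD1 n 3 : ℤ) : ℝ) := by rw [c3a]; linarith only [hwdef, hn1, hj0]
  have hB := log_norm_RCT_le hy h0 h1 h2 h3 hw2 hw3
  rw [abs_of_pos (show (0 : ℝ) < (normT (aTD1 n) (bTD1 n) : ℝ) by exact_mod_cast TwoTaleSecondTaleLineRate.normT_pos (aTD1 n) (bTD1 n))] at hB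
  have c0 : ((aTD1 n 0 - 1 : ℤ) : ℝ) = 47 * n + 1 := by rw [aTD1_zero]; push_cast; ring
  have c0b : ((bTD1 n 0 : ℤ) : ℝ) = 22 * n + 2 := by rw [bTD1_zero]; push_cast; ring
  have c1 : ((aTD1 n 1 - 1 : ℤ) : ℝ) = 16 * n := by rw [aTD1_one]; push_cast; ring
  have c1b : ((bTD1 n 1 : ℤ) : ℝ) = 9 * n + 1 := by rw [bTD1_one]; push_cast; ring
  have c2 : ((bTD1 n 2 - 1 : ℤ) : ℝ) = 35 * n + 1 := by rw [bTD1_two]; push_cast; ring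
  have c3 : ((bTD1 n 3 - 1 : ℤ) : ℝ) = 38 * n + 1 := by rw [bTD1_three]; push_cast; ring
  rw [c0, c0b, c1, c1b, c2, c3, c2a, c3a, show (2 : ℝ) * ((n : ℝ) * η) = n * (2 * η) by ring] at hB
  rw [hG, constLineTD1]
  clear_value w
  refine hB.trans ?_
  linarith only [e1b, e2a, e3b, e4a, e5a, e6b, e7a, e8b, l1, l2, l3, l4, log_normT_TD1_le hn, hlog12, hlog27]

end Summit.KontsevichZagierPeriods.Zeta5Search.TwoTaleSecondTaleD1LineRate

end
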